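import Summits.NavierStokesRegularity.NavierStokesRegularity.Theorems.CircuitPump.Negative.LoadBearing

/-!
# `WakeRatchet.EternalViscousRate` (stmt-NavierStokesRegularity-25647): the TREE'S type-I DSS viscous pump
# (`PerpetualPump.CircuitPump`, PROVED) obeys the lattice type-I clock — brick 1 of the bridge
# «CircuitPump witness ⟹ dissipation-balanced block-DSS bounded admissible eternal solution»

CONTEXT.  The kill hypothesis on record for the crux `EternalViscousRate` (⟨25647⟩) is
`ViscousBlockDSSWaves` (negative lemma `EternalViscousRate_false_of_ViscousBlockDSSWaves`, p608789): existence, on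
an `E₂(R)` table at arbitrarily small scale ratio, of a non-trivial UNIFORMLY BOUNDED block-self-similar admissible
eternal solution with covariant viscosity `ν̂ > 0` — in physical variables an exactly discretely self-similar
TYPE-I blow-up of the viscous lattice.  The item's notes call this object «open / not constructible».  It is not:
the closed route PerpetualPump PROVED `Theses.PerpetualPump.CircuitPump`
(`Theorems.PerpetualPumpCircuitPump.CircuitPump_proof`): for every `lam₀ > 1` there are `lam ∈ (1, lam₀)`
(`lam = Λ = (1+ε₀)^{5/2}`, so ARBITRARILY FINE scale ratio), a symmetric cyclic-cancelling table (the m = 2 seeded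
graded Toda pump, seed `ε(lam) → 0` as `lam → 1`, hence spread `R(lam) = 2/ε(lam) → ∞`) and a non-trivial solution
`X` of the viscous circuit on `(-∞,0)` that is exactly DSS with period 1 and TYPE I in the PDE weight,
`lam^{3n/5}|X_{i,n}(t)| ≤ C/√(-t)` (`CircuitPumpNegative.IsTypeI`).

THIS FILE (pure real analysis on the negative side's vocabulary `SolvesODE` / `IsTypeI` / `rhsF`, any number of
modes, any real table; no self-similarity used): the PDE-weight Type-I bound SELF-IMPROVES TO THE LATTICE TYPE-I
CLOCK `lam^{n}(-t)|X_{i,n}(t)| ≤ K` (`typeI_clock_bound`), i.e. exactly `UniformBound` of the renormalised family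
`W_n(σ) = Λ^n e^{-σ} X_n(-e^{-σ})` of `RenormalisedCascadeWaves` — the far-past decay `|X_{i,n}(t)| ≤ K lam^{-n}/(-t)`
that the companion critical bound `CircuitPumpNegative.typeI_critical_bound` (`lam^{n/5}|X| ≤ C'`, which gives the
`bdd` clause of the renormalised family) does not give.
Mechanism: the quadratic part of the circuit field is `≤ S_i C² lam^{1/5} lam^{-n/5}/(-t)` under Type I
(`abs_quadratic_le`, the estimate inside `CircuitPumpNegative.abs_rhsF_le`, re-derived here), and against the damping `lam^{4n/5}` a forcing that is
monotone in `t` is integrated by the damped fence `fence_damped` (integrating factor `e^{at}`, barrier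
`image_norm_le_of_norm_deriv_right_le_deriv_boundary'`) from `t₀ → -∞`, where the Type-I bound kills the
initial term.

REMAINING BRICKS of the bridge (each M-sized, patterns in tree): (2) the law dictionary `rhsF` (Option-(Fin 3)
encoding) ↔ `quadTerm` ↔ `IsEternalVisc.law` by the chain rule through `t = -e^{-σ}`
(pattern: `ClockedFrames.frame_law`, `DSSOneShift.shellVec_quadTerm_normalForm`); (3) the action clause: a second
damped round gives `|X_{i,n}(t)| ≲ (-t)^{-3/2}` in the far past, `typeI_critical_bound` gives boundedness near
`t = 0`, and the Jacobian change of variables `σ ↦ -e^{-σ}` turns `∫‖W_n‖dσ` into `Λ^n ∫_{(-∞,0)}‖X_n‖dt`,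
shell-independent by the period-1 self-similarity; (4) `InTableClass (2/ε)` of the zero-padded (m = 2 ⊂ 4) Toda
table.  With (1)–(4) the inner statement of `EternalViscousRate` fails at `(R(lam), ε₀(lam))` for EVERY `a > 1`
(rate pinned to 1 by `WakeRatchetViscDSS.viscBlockDSS_ratio`) along `ε₀(lam) → 0`: the crux can hold only through an
`R`-dependent threshold `εs(R)` (no spread-uniform `εs`), the formal counterpart of the rotor-circuit numerics on
⟨25646⟩.  HONEST LABEL: MODEL lattice ODEs only (Tao 2016 §4); no item is closed; nothing here bears on the
Navier–Stokes equations.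
-/

set_option linter.dupNamespace false

noncomputable section

open scoped BigOperators
open Real Set Filter Topology

namespace Summit.NavierStokesRegularity.NavierStokesRegularity.Theorems.WakeRatchetCircuitPumpClock

open Summit.NavierStokesRegularity.NavierStokesRegularity.Theorems.CircuitPumpNegative

variable {m : ℕ}

/-! ## Pointwise consequences of the Type-I bound (restated from `CircuitPump/Negative/CriticalBoundRoundOne`,
same seat's vocabulary; kept private here so that this file depends on `LoadBearing` only) -/

/-- Unpacking Type I: `|X_{i,n}(t)| ≤ C·lam^{-3n/5}/√(-t)`. [folklore] -/
private theorem abs_le_of_typeI {lam : ℝ} (hlam : 1 < lam) {X : Fin m → ℤ → ℝ → ℝ} {C : ℝ}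
    (hTI : ∀ (i : Fin m) (n : ℤ) (t : ℝ), t < 0 → lam ^ ((3 / 5 : ℝ) * n) * |X i n t| ≤ C / Real.sqrt (-t))
    (i : Fin m) (n : ℤ) (t : ℝ) (ht : t < 0) :
    |X i n t| ≤ C * lam ^ (-((3 / 5 : ℝ) * n)) / Real.sqrt (-t) := by
  have hpos : 0 < lam := by linarith
  have hw : 0 < lam ^ ((3 / 5 : ℝ) * n) := Real.rpow_pos_of_pos hpos _
  have h := hTI i n t ht
  have hinv : lam ^ (-((3 / 5 : ℝ) * n)) = (lam ^ ((3 / 5 : ℝ) * n))⁻¹ := Real.rpow_neg hpos.le _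
  rw [hinv]
  rw [mul_comm] at h
  have := (le_div_iff₀ hw).2 h
  calc |X i n t| ≤ C / Real.sqrt (-t) / lam ^ ((3 / 5 : ℝ) * n) := this
    _ = C * (lam ^ ((3 / 5 : ℝ) * n))⁻¹ / Real.sqrt (-t) := by ring

/-- The Type-I constant is nonnegative as soon as there is one mode. [folklore] -/
private theorem typeI_const_nonneg {lam : ℝ} (hlam : 1 < lam) {X : Fin m → ℤ → ℝ → ℝ} {C : ℝ}
    (hTI : ∀ (i : Fin m) (n : ℤ) (t : ℝ), t < 0 → lam ^ ((3 / 5 : ℝ) * n) * |X i n t| ≤ C / Real.sqrt (-t))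
    (i : Fin m) : 0 ≤ C := by
  have hpos : 0 < lam := by linarith
  have h := hTI i 0 (-1) (by norm_num)
  have h1 : 0 ≤ lam ^ ((3 / 5 : ℝ) * ((0 : ℤ) : ℝ)) * |X i 0 (-1)| :=
    mul_nonneg (Real.rpow_nonneg hpos.le _) (abs_nonneg _)
  have : (0 : ℝ) ≤ C / Real.sqrt (-(-1 : ℝ)) := h1.trans h
  simpa using this

/-- One nonlinear monomial under Type I (offsets `d, o₁, o₂` with `-d - 3(o₁+o₂)/5 ≤ 1/5`):
`|c·lam^{n-d}·X_{i₁,n+o₁}·X_{i₂,n+o₂}| ≤ |c| C² lam^{1/5} lam^{-n/5}/(-t)`. [folklore] -/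
private theorem monomial_abs_le {lam : ℝ} (hlam : 1 < lam) {X : Fin m → ℤ → ℝ → ℝ} {C : ℝ}
    (hTI : ∀ (i : Fin m) (n : ℤ) (t : ℝ), t < 0 → lam ^ ((3 / 5 : ℝ) * n) * |X i n t| ≤ C / Real.sqrt (-t))
    (c d : ℝ) (o₁ o₂ : ℤ) (hd : -d - 3 * ((o₁ : ℝ) + o₂) / 5 ≤ 1 / 5)
    (i₁ i₂ : Fin m) (n : ℤ) (t : ℝ) (ht : t < 0) :
    |c * lam ^ ((n : ℝ) - d) * X i₁ (n + o₁) t * X i₂ (n + o₂) t| ≤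
      |c| * C ^ 2 * lam ^ (1 / 5 : ℝ) * lam ^ (-((1 / 5 : ℝ) * n)) / (-t) := by
  have hpos : 0 < lam := by linarith
  have hnt : 0 < -t := by linarith
  have hC : 0 ≤ C := typeI_const_nonneg hlam hTI i₁
  have hsq : 0 < Real.sqrt (-t) := Real.sqrt_pos.2 hnt
  have h1 := abs_le_of_typeI hlam hTI i₁ (n + o₁) t ht
  have h2 := abs_le_of_typeI hlam hTI i₂ (n + o₂) t ht
  have hb1 : 0 ≤ C * lam ^ (-((3 / 5 : ℝ) * ((n + o₁ : ℤ) : ℝ))) / Real.sqrt (-t) := by positivity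
  have hprod : |X i₁ (n + o₁) t| * |X i₂ (n + o₂) t| ≤
      (C * lam ^ (-((3 / 5 : ℝ) * ((n + o₁ : ℤ) : ℝ))) / Real.sqrt (-t)) *
        (C * lam ^ (-((3 / 5 : ℝ) * ((n + o₂ : ℤ) : ℝ))) / Real.sqrt (-t)) :=
    mul_le_mul h1 h2 (abs_nonneg _) hb1
  have hexp : lam ^ ((n : ℝ) - d) * (lam ^ (-((3 / 5 : ℝ) * ((n + o₁ : ℤ) : ℝ))) *
      lam ^ (-((3 / 5 : ℝ) * ((n + o₂ : ℤ) : ℝ)))) ≤ lam ^ (1 / 5 : ℝ) * lam ^ (-((1 / 5 : ℝ) * n)) := by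
    rw [← Real.rpow_add hpos, ← Real.rpow_add hpos, ← Real.rpow_add hpos]
    apply Real.rpow_le_rpow_of_exponent_le hlam.le
    push_cast
    linarith
  have hsqsq : Real.sqrt (-t) * Real.sqrt (-t) = -t := Real.mul_self_sqrt hnt.le
  rw [abs_mul, abs_mul, abs_mul, abs_of_pos (Real.rpow_pos_of_pos hpos _)]
  calc |c| * lam ^ ((n : ℝ) - d) * |X i₁ (n + o₁) t| * |X i₂ (n + o₂) t|
      = |c| * lam ^ ((n : ℝ) - d) * (|X i₁ (n + o₁) t| * |X i₂ (n + o₂) t|) := by ring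
    _ ≤ |c| * lam ^ ((n : ℝ) - d) * ((C * lam ^ (-((3 / 5 : ℝ) * ((n + o₁ : ℤ) : ℝ))) / Real.sqrt (-t)) *
        (C * lam ^ (-((3 / 5 : ℝ) * ((n + o₂ : ℤ) : ℝ))) / Real.sqrt (-t))) :=
        mul_le_mul_of_nonneg_left hprod (by positivity)
    _ = |c| * C ^ 2 * (lam ^ ((n : ℝ) - d) * (lam ^ (-((3 / 5 : ℝ) * ((n + o₁ : ℤ) : ℝ))) *
        lam ^ (-((3 / 5 : ℝ) * ((n + o₂ : ℤ) : ℝ))))) / (Real.sqrt (-t) * Real.sqrt (-t)) := by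
        field_simp
    _ ≤ |c| * C ^ 2 * (lam ^ (1 / 5 : ℝ) * lam ^ (-((1 / 5 : ℝ) * n))) / (Real.sqrt (-t) * Real.sqrt (-t)) := by
        apply div_le_div_of_nonneg_right _ (by positivity)
        exact mul_le_mul_of_nonneg_left hexp (by positivity)
    _ = |c| * C ^ 2 * lam ^ (1 / 5 : ℝ) * lam ^ (-((1 / 5 : ℝ) * n)) / (-t) := by rw [hsqsq]; ring

/-- The offset labels of the crux all satisfy the exponent condition of `monomial_abs_le`. [folklore] -/
private theorem offset_exponent_le (μ : Option (Fin 3)) :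
    -((if μ = some 2 then 1 else 0 : ℝ)) -
        3 * (((((if μ = some 0 then 1 else 0) - (if μ = some 2 then 1 else 0) : ℤ)) : ℝ) +
          ((((if μ = some 1 then 1 else 0) - (if μ = some 2 then 1 else 0) : ℤ)) : ℝ)) / 5 ≤ 1 / 5 := by
  rcases μ with _ | j
  · simp
  · fin_cases j <;> simp <;> norm_num

/-- **The quadratic part of the circuit field under Type I.**  `|F_{i,n}(t) + lam^{4n/5}X_{i,n}(t)| ≤
S_i C² lam^{1/5} lam^{-n/5}/(-t)` (`S_i = Σ |coeff · · i ·|`): the estimate inside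
`CircuitPumpNegative.abs_rhsF_le`, stated for the forcing alone.
[cite: Tao2016AveragedNS, §4 (4.1)–(4.3) and the viscous equation displayed before Thm. 4.2; cell vocabulary (`rhsF`)] -/
theorem abs_quadratic_le {lam : ℝ} (hlam : 1 < lam) (coeff : Fin m → Fin m → Fin m → Option (Fin 3) → ℝ)
    {X : Fin m → ℤ → ℝ → ℝ} {C : ℝ}
    (hTI : ∀ (i : Fin m) (n : ℤ) (t : ℝ), t < 0 → lam ^ ((3 / 5 : ℝ) * n) * |X i n t| ≤ C / Real.sqrt (-t))
    (i : Fin m) (n : ℤ) (t : ℝ) (ht : t < 0) :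
    |rhsF lam coeff X i n t + lam ^ ((4 / 5 : ℝ) * n) * X i n t| ≤
      (∑ i₁ : Fin m, ∑ i₂ : Fin m, ∑ μ : Option (Fin 3), |coeff i₁ i₂ i μ|) * C ^ 2 * lam ^ (1 / 5 : ℝ) *
        lam ^ (-((1 / 5 : ℝ) * n)) / (-t) := by
  have hq : rhsF lam coeff X i n t + lam ^ ((4 / 5 : ℝ) * n) * X i n t =
      ∑ i₁ : Fin m, ∑ i₂ : Fin m, ∑ μ : Option (Fin 3),
        coeff i₁ i₂ i μ * lam ^ ((n : ℝ) - (if μ = some 2 then 1 else 0)) *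
          X i₁ (n + ((if μ = some 0 then 1 else 0) - (if μ = some 2 then 1 else 0))) t *
          X i₂ (n + ((if μ = some 1 then 1 else 0) - (if μ = some 2 then 1 else 0))) t := by
    unfold rhsF; ring
  rw [hq]
  refine (Finset.abs_sum_le_sum_abs _ _).trans ?_
  rw [Finset.sum_mul, Finset.sum_mul, Finset.sum_mul, Finset.sum_div]
  refine Finset.sum_le_sum fun i₁ _ => ?_
  refine (Finset.abs_sum_le_sum_abs _ _).trans ?_
  rw [Finset.sum_mul, Finset.sum_mul, Finset.sum_mul, Finset.sum_div]
  refine Finset.sum_le_sum fun i₂ _ => ?_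
  refine (Finset.abs_sum_le_sum_abs _ _).trans ?_
  rw [Finset.sum_mul, Finset.sum_mul, Finset.sum_mul, Finset.sum_div]
  refine Finset.sum_le_sum fun μ _ => ?_
  exact monomial_abs_le hlam hTI (coeff i₁ i₂ i μ) _ _ _ (offset_exponent_le μ) i₁ i₂ n t ht

/-- **Damped fence.**  If `f' + a f` is bounded by `G` on `[t₀, t)` (`a > 0`), then
`e^{at}|f(t)| ≤ e^{at₀}|f(t₀)| + G (e^{at} - e^{at₀})/a` (integrating factor `e^{as}` and the barrier
`image_norm_le_of_norm_deriv_right_le_deriv_boundary'`). [folklore] -/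
theorem fence_damped {f f' : ℝ → ℝ} {t₀ t a G : ℝ} (ht₀ : t₀ ≤ t) (ha : 0 < a)
    (hf : ∀ x ∈ Icc t₀ t, HasDerivAt f (f' x) x)
    (hb : ∀ x ∈ Ico t₀ t, |f' x + a * f x| ≤ G) :
    Real.exp (a * t) * |f t| ≤
      Real.exp (a * t₀) * |f t₀| + G * (Real.exp (a * t) - Real.exp (a * t₀)) / a := by
  set F : ℝ → ℝ := fun x => Real.exp (a * x) * f x with hF
  set F' : ℝ → ℝ := fun x => Real.exp (a * x) * (f' x + a * f x) with hF'
  set B : ℝ → ℝ := fun x => Real.exp (a * t₀) * |f t₀| + G * (Real.exp (a * x) - Real.exp (a * t₀)) / a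
    with hB
  set B' : ℝ → ℝ := fun x => G * Real.exp (a * x) with hB'
  have hexp : ∀ x : ℝ, HasDerivAt (fun y : ℝ => Real.exp (a * y)) (Real.exp (a * x) * a) x := by
    intro x
    have h := ((hasDerivAt_id x).const_mul a).exp
    simpa only [id, mul_one] using h
  have hFd : ∀ x ∈ Icc t₀ t, HasDerivAt F (F' x) x := by
    intro x hx
    refine ((hexp x).mul (hf x hx)).congr_deriv ?_
    simp only [hF']
    ring
  have hBd : ∀ x : ℝ, HasDerivAt B (B' x) x := by
    intro x
    have h : HasDerivAt
        (fun y : ℝ => Real.exp (a * t₀) * |f t₀| + G * (Real.exp (a * y) - Real.exp (a * t₀)) / a)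
        (0 + G * (Real.exp (a * x) * a - 0) / a) x :=
      (hasDerivAt_const x _).add ((((hexp x).sub (hasDerivAt_const x _)).const_mul G).div_const a)
    refine h.congr_deriv ?_
    simp only [hB']
    field_simp
    ring
  have hFc : ContinuousOn F (Icc t₀ t) := fun x hx => (hFd x hx).continuousAt.continuousWithinAt
  have hF'w : ∀ x ∈ Ico t₀ t, HasDerivWithinAt F (F' x) (Ici x) x :=
    fun x hx => (hFd x (Ico_subset_Icc_self hx)).hasDerivWithinAt
  have hBc : ContinuousOn B (Icc t₀ t) := fun x _ => (hBd x).continuousAt.continuousWithinAt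
  have hB'w : ∀ x ∈ Ico t₀ t, HasDerivWithinAt B (B' x) (Ici x) x := fun x _ => (hBd x).hasDerivWithinAt
  have hstart : ‖F t₀‖ ≤ B t₀ := by
    simp [hF, hB, abs_of_pos (Real.exp_pos _)]
  have hbound : ∀ x ∈ Ico t₀ t, ‖F' x‖ ≤ B' x := by
    intro x hx
    rw [Real.norm_eq_abs]
    simp only [hF', hB', abs_mul, abs_of_pos (Real.exp_pos _)]
    rw [mul_comm G]
    exact mul_le_mul_of_nonneg_left (hb x hx) (Real.exp_pos _).le
  have key := image_norm_le_of_norm_deriv_right_le_deriv_boundary' hFc hF'w hstart hBc hB'w hbound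
    (right_mem_Icc.2 ht₀)
  simpa [hF, hB, Real.norm_eq_abs, abs_mul, abs_of_pos (Real.exp_pos _)] using key

/-- **Damping against a past-monotone forcing.**  Let `f` solve `f' = -a f + g` on `(-∞, 0)` with `a > 0`,
`|g(x)| ≤ D/(-x)` (`D ≥ 0`) and `|f(x)| ≤ E/√(-x)`.  Then `|f(t)| ≤ D/(a(-t))` for every `t < 0`: run the damped
fence from `t₀` with the bound `G = D/(-t)` (valid on `[t₀,t)` since `1/(-x) ≤ 1/(-t)`), and let `t₀ → -∞`,
where `e^{a(t₀ - t)} E/√(-t) → 0`. [folklore] -/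
theorem abs_le_of_damped {f f' : ℝ → ℝ} {a D E : ℝ} (ha : 0 < a) (hD : 0 ≤ D)
    (hf : ∀ x : ℝ, x < 0 → HasDerivAt f (f' x) x)
    (hg : ∀ x : ℝ, x < 0 → |f' x + a * f x| ≤ D / (-x))
    (hE : ∀ x : ℝ, x < 0 → |f x| ≤ E / Real.sqrt (-x)) {t : ℝ} (ht : t < 0) :
    |f t| ≤ D / (a * (-t)) := by
  have hnt : 0 < -t := neg_pos.2 ht
  -- the fence from any `t₀ ≤ t`, rewritten without the integrating factor
  have hstep : ∀ t₀ : ℝ, t₀ ≤ t →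
      |f t| ≤ Real.exp (a * (t₀ - t)) * (E / Real.sqrt (-t)) + D / (a * (-t)) := by
    intro t₀ ht₀
    have ht₀0 : t₀ < 0 := lt_of_le_of_lt ht₀ ht
    have hfence := fence_damped ht₀ ha (fun x hx => hf x (lt_of_le_of_lt hx.2 ht))
      (fun x hx => (hg x (lt_trans hx.2 ht)).trans
        (div_le_div_of_nonneg_left hD hnt (by linarith [hx.2])))
    -- `|f t₀| ≤ E/√(-t₀) ≤ E/√(-t)` is not needed in this sharp form: use `E/√(-t₀)` and `√(-t) ≤ √(-t₀)`
    have hE₀ : |f t₀| ≤ E / Real.sqrt (-t) := by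
      have h1 := hE t₀ ht₀0
      have hEnn : 0 ≤ E := by
        have h2 : 0 ≤ E / Real.sqrt (-t₀) := (abs_nonneg _).trans h1
        have hs : 0 < Real.sqrt (-t₀) := Real.sqrt_pos.2 (by linarith)
        by_contra hneg
        have : E / Real.sqrt (-t₀) < 0 := div_neg_of_neg_of_pos (not_le.1 hneg) hs
        linarith
      refine h1.trans (div_le_div_of_nonneg_left hEnn (Real.sqrt_pos.2 hnt) ?_)
      exact Real.sqrt_le_sqrt (by linarith)
    have hpos_t : 0 < Real.exp (a * t) := Real.exp_pos _
    -- divide the fence by `e^{at}`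
    have h1 : |f t| ≤ Real.exp (a * t₀) / Real.exp (a * t) * |f t₀| +
        D / (-t) * (1 - Real.exp (a * t₀) / Real.exp (a * t)) / a := by
      rw [← sub_nonneg] at hfence ⊢
      have e : Real.exp (a * t) * (Real.exp (a * t₀) / Real.exp (a * t) * |f t₀| +
          D / (-t) * (1 - Real.exp (a * t₀) / Real.exp (a * t)) / a - |f t|) =
          Real.exp (a * t₀) * |f t₀| + D / (-t) * (Real.exp (a * t) - Real.exp (a * t₀)) / a -
            Real.exp (a * t) * |f t| := by
        field_simp
      have := mul_nonneg_iff_of_pos_left hpos_t |>.1 (e ▸ hfence)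
      exact this
    have hratio : Real.exp (a * t₀) / Real.exp (a * t) = Real.exp (a * (t₀ - t)) := by
      rw [← Real.exp_sub]; congr 1; ring
    rw [hratio] at h1
    have hr0 : 0 ≤ Real.exp (a * (t₀ - t)) := (Real.exp_pos _).le
    have h2 : D / (-t) * (1 - Real.exp (a * (t₀ - t))) / a ≤ D / (a * (-t)) := by
      rw [div_mul_eq_mul_div, div_div, mul_comm (-t) a]
      refine div_le_div_of_nonneg_right ?_ (by positivity)
      nlinarith
    calc |f t| ≤ Real.exp (a * (t₀ - t)) * |f t₀| + D / (-t) * (1 - Real.exp (a * (t₀ - t))) / a := h1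
      _ ≤ Real.exp (a * (t₀ - t)) * (E / Real.sqrt (-t)) + D / (a * (-t)) :=
          add_le_add (mul_le_mul_of_nonneg_left hE₀ hr0) h2
  -- let `t₀ → -∞`
  have hlin : Tendsto (fun t₀ : ℝ => a * (t₀ - t)) atBot atBot := by
    refine tendsto_atBot_atBot.2 fun b => ⟨b / a + t, fun x hx => ?_⟩
    have : a * (x - t) ≤ a * (b / a + t - t) := mul_le_mul_of_nonneg_left (by linarith) ha.le
    calc a * (x - t) ≤ a * (b / a + t - t) := this
      _ = b := by field_simp; ring
  have hlim : Tendsto (fun t₀ : ℝ => Real.exp (a * (t₀ - t)) * (E / Real.sqrt (-t)) + D / (a * (-t)))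
      atBot (𝓝 (0 * (E / Real.sqrt (-t)) + D / (a * (-t)))) :=
    ((Real.tendsto_exp_atBot.comp hlin).mul_const _).add_const _
  rw [zero_mul, zero_add] at hlim
  exact ge_of_tendsto hlim ((eventually_le_atBot t).mono fun t₀ ht₀ => hstep t₀ ht₀)

/-- **TYPE I SELF-IMPROVES TO THE LATTICE TYPE-I CLOCK.**  For every solution of a viscous Tao circuit on
`(-∞,0)` (`SolvesODE`, any number of modes, any real table) with the PDE-weight Type-I bound (`IsTypeI`:
`lam^{3n/5}|X_{i,n}(t)| ≤ C/√(-t)`), the lattice type-I clock holds uniformly in the mode, the shell and the time: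
`lam^{n}(-t)|X_{i,n}(t)| ≤ K` with `K = S_tot C² lam^{1/5}` — i.e. the renormalised family
`W_n(σ) = Λ^n e^{-σ}X_n(-e^{-σ})` is UNIFORMLY BOUNDED (`UniformBound`).  Applies verbatim to the witness of
`PerpetualPump.CircuitPump` (`CircuitPump_proof`).
[cite: Tao2016AveragedNS, §4, the viscous equation displayed before Thm. 4.2, §6.4 (self-similar variables); cell vocabulary] -/
theorem typeI_clock_bound {lam : ℝ} (hlam : 1 < lam)
    (coeff : Fin m → Fin m → Fin m → Option (Fin 3) → ℝ) (X : Fin m → ℤ → ℝ → ℝ)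
    (hode : SolvesODE lam coeff X) (hTI : IsTypeI lam X) :
    ∃ K : ℝ, ∀ (i : Fin m) (n : ℤ) (t : ℝ), t < 0 → lam ^ (n : ℝ) * (-t) * |X i n t| ≤ K := by
  obtain ⟨C, hC⟩ := hTI
  have hpos : 0 < lam := by linarith
  refine ⟨(∑ i : Fin m, ∑ i₁ : Fin m, ∑ i₂ : Fin m, ∑ μ : Option (Fin 3), |coeff i₁ i₂ i μ|) * C ^ 2 *
      lam ^ (1 / 5 : ℝ), fun i n t ht => ?_⟩
  have hSi : 0 ≤ ∑ i₁ : Fin m, ∑ i₂ : Fin m, ∑ μ : Option (Fin 3), |coeff i₁ i₂ i μ| := by positivity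
  have hSle : (∑ i₁ : Fin m, ∑ i₂ : Fin m, ∑ μ : Option (Fin 3), |coeff i₁ i₂ i μ|) ≤
      ∑ i : Fin m, ∑ i₁ : Fin m, ∑ i₂ : Fin m, ∑ μ : Option (Fin 3), |coeff i₁ i₂ i μ| :=
    Finset.single_le_sum (f := fun i => ∑ i₁ : Fin m, ∑ i₂ : Fin m, ∑ μ : Option (Fin 3), |coeff i₁ i₂ i μ|)
      (fun j _ => by positivity) (Finset.mem_univ i)
  have hnt : 0 < -t := neg_pos.2 ht
  have hCnn : 0 ≤ C := typeI_const_nonneg hlam hC i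
  -- damping rate and forcing size at shell `n`
  obtain ⟨a, ha, hapos⟩ : ∃ a : ℝ, a = lam ^ ((4 / 5 : ℝ) * n) ∧ 0 < a :=
    ⟨_, rfl, Real.rpow_pos_of_pos hpos _⟩
  obtain ⟨D, hD, hDnn⟩ : ∃ D : ℝ,
      D = (∑ i₁ : Fin m, ∑ i₂ : Fin m, ∑ μ : Option (Fin 3), |coeff i₁ i₂ i μ|) * C ^ 2 * lam ^ (1 / 5 : ℝ) *
        lam ^ (-((1 / 5 : ℝ) * n)) ∧ 0 ≤ D := by
    refine ⟨_, rfl, ?_⟩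
    have h2 : 0 ≤ lam ^ (1 / 5 : ℝ) := Real.rpow_nonneg hpos.le _
    have h3 : 0 ≤ lam ^ (-((1 / 5 : ℝ) * n)) := Real.rpow_nonneg hpos.le _
    positivity
  -- the damped bound `|X_{i,n}(t)| ≤ D/(a(-t))`
  have hg : ∀ x : ℝ, x < 0 → |rhsF lam coeff X i n x + a * X i n x| ≤ D / (-x) := by
    intro x hx
    rw [ha, hD]
    exact abs_quadratic_le hlam coeff hC i n x hx
  have hE : ∀ x : ℝ, x < 0 → |X i n x| ≤ C * lam ^ (-((3 / 5 : ℝ) * n)) / Real.sqrt (-x) :=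
    fun x hx => abs_le_of_typeI hlam hC i n x hx
  have hX := abs_le_of_damped hapos hDnn (fun x hx => hode i n x hx) hg hE ht
  -- exponent bookkeeping: `lam^{n} · D / a = S_i C² lam^{1/5}`
  have hw : lam ^ (n : ℝ) * lam ^ (-((1 / 5 : ℝ) * n)) = a := by
    rw [ha, ← Real.rpow_add hpos]; congr 1; ring
  set S : ℝ := ∑ i₁ : Fin m, ∑ i₂ : Fin m, ∑ μ : Option (Fin 3), |coeff i₁ i₂ i μ| with hS
  set Stot : ℝ := ∑ i : Fin m, ∑ i₁ : Fin m, ∑ i₂ : Fin m, ∑ μ : Option (Fin 3), |coeff i₁ i₂ i μ| with hStot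
  have hle : lam ^ (n : ℝ) * (-t) * |X i n t| ≤ S * C ^ 2 * lam ^ (1 / 5 : ℝ) := by
    have hw0 : 0 ≤ lam ^ (n : ℝ) * (-t) := mul_nonneg (Real.rpow_nonneg hpos.le _) hnt.le
    have htne : t ≠ 0 := ht.ne
    have hane : a ≠ 0 := hapos.ne'
    calc lam ^ (n : ℝ) * (-t) * |X i n t| ≤ lam ^ (n : ℝ) * (-t) * (D / (a * (-t))) :=
          mul_le_mul_of_nonneg_left hX hw0
      _ = S * C ^ 2 * lam ^ (1 / 5 : ℝ) * (lam ^ (n : ℝ) * lam ^ (-((1 / 5 : ℝ) * n))) / a := by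
          rw [hD]; field_simp
      _ = S * C ^ 2 * lam ^ (1 / 5 : ℝ) := by
          rw [hw]; field_simp
  refine hle.trans ?_
  have h2 : 0 ≤ C ^ 2 * lam ^ (1 / 5 : ℝ) := mul_nonneg (sq_nonneg C) (Real.rpow_nonneg hpos.le _)
  calc S * C ^ 2 * lam ^ (1 / 5 : ℝ) = S * (C ^ 2 * lam ^ (1 / 5 : ℝ)) := by ring
    _ ≤ Stot * (C ^ 2 * lam ^ (1 / 5 : ℝ)) := mul_le_mul_of_nonneg_right hSle h2
    _ = Stot * C ^ 2 * lam ^ (1 / 5 : ℝ) := by ring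

/-- **The lattice clock of the tree's perpetual pump.**  Every witness of `PerpetualPump.CircuitPump` —
PROVED in the tree by `PerpetualPumpCircuitPump.CircuitPump_proof` (taken here as the named hypothesis `h`, to
be discharged by that theorem; its module chain is not imported by this file), at arbitrarily fine scale ratio —
carries, besides its PDE-weight Type-I bound, the lattice type-I clock `lam^{n}(-t)|X_{i,n}(t)| ≤ K`: in the
renormalised variables of `RenormalisedCascadeWaves` its profile family is UNIFORMLY BOUNDED — the `UniformBound`
clause of a `ViscousBlockDSSWaves`-type witness against `EternalViscousRate` (⟨25647⟩).
[cite: Tao2016AveragedNS, §4 Thm. 4.2 (statement shape), the viscous equation before it, §6.4; cell vocabulary] -/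
theorem clock_of_circuitPump
    (h : Summit.NavierStokesRegularity.NavierStokesRegularity.Theses.PerpetualPump.CircuitPump) :
    ∀ lam₀ : ℝ, 1 < lam₀ → ∃ lam : ℝ, 1 < lam ∧ lam < lam₀ ∧
      ∃ (m : ℕ) (coeff : Fin m → Fin m → Fin m → Option (Fin 3) → ℝ) (k : ℕ) (X : Fin m → ℤ → ℝ → ℝ),
        IsPump lam m coeff k X ∧
        ∃ K : ℝ, ∀ (i : Fin m) (n : ℤ) (t : ℝ), t < 0 → lam ^ (n : ℝ) * (-t) * |X i n t| ≤ K := by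
  intro lam₀ hlam₀
  obtain ⟨lam, hlam, hlt, m, coeff, k, X, hP⟩ := (circuitPump_iff.1 h) lam₀ hlam₀
  have hode : SolvesODE lam coeff X := hP.2.2.2.1
  have hTI : IsTypeI lam X := hP.2.2.2.2.2.1
  exact ⟨lam, hlam, hlt, m, coeff, k, X, hP, typeI_clock_bound hlam coeff X hode hTI⟩

end Summit.NavierStokesRegularity.NavierStokesRegularity.Theorems.WakeRatchetCircuitPumpClock

end
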